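import Literature.Combinatorics.SimpleGraph.PaleySosLevelTwo
import Literature.Combinatorics.SimpleGraph.PaleyDegenerateModuli
import HarnessLib

/-!
# The FKM-free level-2 rung: `las⁽²⁾ ≥ 2⁻⁸ n^{1/4}` for conference graphs, and the Paley graph

Topic `Literature/Combinatorics/SimpleGraph`; crux-triage evidence for stmt-PneNP-9817 (card
`cross-pattern-weil-saving` of crux `PaleySosRung`), reusable by route RamseyUncertifiable #2/#4.

`abs_thetaForm_le_naive`: for ANY symmetric `S` with `|S_{xy}| ≤ 1` and `S² = nI − J` (conference
matrix) and ANY `Vm`, the 4-cycle form satisfies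
`|Σ Vm_ab Vm_cd S_ac S_ad S_bc S_bd| ≤ n√n · Σ Vm_ab²` (Kunisky–Yu's "naive `O(p^{3/2})`", Remark 4.21):
Cauchy–Schwarz, AM–GM and `‖Su‖² ≤ n‖u‖²`.  Plugged into the tree's
`conference_card_mul_le_lasserreStableBound_two` with `α = 2⁻⁸ p^{-3/4}` it gives
`las⁽²⁾(Ḡ) ≥ 2⁻⁸ n^{1/4}` for EVERY conference graph with zero Seidel row sums
(`conference_lasserre_two_ge_quarter`), in particular `las⁽²⁾(P_p) ≥ 2⁻⁸ p^{1/4}` for every prime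
`p ≡ 1 (mod 4)` — the `t = 2` instance of the crux with NO Deligne/FKM input
(`paley_lasserre_two_ge_quarter`, `paleySosRung_level_two_quarter`; compare the vendored
`kuniskyYu2022_theorem_1_2`, exponent `1/3`, which rests on FKM15 Cor. 3.2).

## References

* D. Kunisky, X. Yu, arXiv:2211.02713 (2022), Remark 4.21 ("a naive argument here can easily show a
  bound of O(p^{3/2})"), Theorem 1.2.  [KuniskyYu2022]
* R. Meka, A. Potechin, A. Wigderson, arXiv:1503.06447 (STOC 2015), Claim 8.3 (the `√n` saving is
  all the level-`r` certificate consumes).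
-/

noncomputable section

namespace Literature.Combinatorics.SimpleGraph

open Matrix Finset

section Naive

variable {V : Type*} [Fintype V] [DecidableEq V] {S : Matrix V V ℝ}

/-- **Naive bound on the 4-cycle graph-matrix form of a conference matrix**:
`|Θ(Vm)| ≤ n^{3/2} ‖Vm‖_F²` for every `Vm` (no zero-diagonal or symmetry needed).
[cite: KuniskyYu2022, Remark 4.21] -/
theorem abs_thetaForm_le_naive (hSs : ∀ x y, S x y = S y x) (hSb : ∀ x y, |S x y| ≤ 1)
    (hsq : S * S = (Fintype.card V : ℝ) • (1 : Matrix V V ℝ) - of fun _ _ => 1)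
    (Vm : Matrix V V ℝ) :
    |∑ a, ∑ b, ∑ c, ∑ d, Vm a b * Vm c d * (S a c * S a d * S b c * S b d)| ≤
      (Fintype.card V : ℝ) * Real.sqrt (Fintype.card V) * ∑ a, ∑ b, Vm a b ^ 2 := by
  set n : ℝ := (Fintype.card V : ℝ) with hn
  have hn0 : 0 ≤ n := Nat.cast_nonneg _
  -- pair-indexed data
  set v : V × V → ℝ := fun x => Vm x.1 x.2 with hv
  set ψ : V → V × V → ℝ := fun c x => S x.1 c * S x.2 c with hψ
  set W : V → V → ℝ := fun c d => ∑ x : V × V, v x * (ψ c x * ψ d x) with hW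
  set T : V × V → V × V → ℝ := fun x y => ∑ c, ψ c x * ψ c y with hT
  have hψb : ∀ c x, ψ c x ^ 2 ≤ 1 := by
    intro c x
    have h1 := hSb x.1 c
    have h2 := hSb x.2 c
    have e : ψ c x ^ 2 = |S x.1 c| ^ 2 * |S x.2 c| ^ 2 := by rw [hψ]; simp [mul_pow, sq_abs]
    rw [e]
    have ha : |S x.1 c| ^ 2 ≤ 1 := by nlinarith [abs_nonneg (S x.1 c)]
    have hb : |S x.2 c| ^ 2 ≤ 1 := by nlinarith [abs_nonneg (S x.2 c)]
    calc |S x.1 c| ^ 2 * |S x.2 c| ^ 2 ≤ 1 * 1 :=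
          mul_le_mul ha hb (by positivity) (by positivity)
      _ = 1 := by ring
  -- (1) the form as `Σ_x v_x W_x`
  have hform : ∑ a, ∑ b, ∑ c, ∑ d, Vm a b * Vm c d * (S a c * S a d * S b c * S b d) =
      ∑ y : V × V, v y * W y.1 y.2 := by
    have e1 : ∑ a, ∑ b, ∑ c, ∑ d, Vm a b * Vm c d * (S a c * S a d * S b c * S b d) =
        ∑ x : V × V, ∑ y : V × V, v x * v y * (ψ y.1 x * ψ y.2 x) := by
      rw [Fintype.sum_prod_type]
      refine Finset.sum_congr rfl fun a _ => Finset.sum_congr rfl fun b _ => ?_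
      rw [Fintype.sum_prod_type]
      refine Finset.sum_congr rfl fun c _ => Finset.sum_congr rfl fun d _ => ?_
      simp only [hv, hψ]
      ring
    rw [e1, Finset.sum_comm]
    refine Finset.sum_congr rfl fun y _ => ?_
    rw [hW, Finset.mul_sum]
    exact Finset.sum_congr rfl fun x _ => by ring
  -- (2) `Σ_{c,d} W_{cd}² = Σ_{x,y} v_x v_y T_{xy}²`
  have hWsq : ∑ y : V × V, W y.1 y.2 ^ 2 = ∑ x : V × V, ∑ x' : V × V, v x * v x' * T x x' ^ 2 := by
    have e1 : ∀ y : V × V, W y.1 y.2 ^ 2 =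
        ∑ x : V × V, ∑ x' : V × V, v x * v x' * (ψ y.1 x * ψ y.1 x' * (ψ y.2 x * ψ y.2 x')) := by
      intro y
      rw [hW, sq, Finset.sum_mul_sum]
      refine Finset.sum_congr rfl fun x _ => Finset.sum_congr rfl fun x' _ => ?_
      ring
    simp_rw [e1]
    rw [Finset.sum_comm]
    refine Finset.sum_congr rfl fun x _ => ?_
    rw [Finset.sum_comm]
    refine Finset.sum_congr rfl fun x' _ => ?_
    have e2 : ∑ y : V × V, v x * v x' * (ψ y.1 x * ψ y.1 x' * (ψ y.2 x * ψ y.2 x')) =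
        v x * v x' * ∑ y : V × V, ψ y.1 x * ψ y.1 x' * (ψ y.2 x * ψ y.2 x') := by
      rw [Finset.mul_sum]
    rw [e2, hT, sq, Fintype.sum_mul_sum, Fintype.sum_prod_type]
  -- (3) row sums of `T²` are at most `n³`
  have hrow : ∀ x : V × V, ∑ x' : V × V, T x x' ^ 2 ≤ n ^ 3 := by
    intro x
    rw [Fintype.sum_prod_type]
    have hinner : ∀ a' : V, ∑ b' : V, T x (a', b') ^ 2 ≤ n * ∑ c, S a' c ^ 2 := by
      intro a'
      have e : ∀ b', T x (a', b') = ∑ c, S b' c * (S a' c * ψ c x) := by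
        intro b'
        rw [hT]
        refine Finset.sum_congr rfl fun c _ => ?_
        simp only [hψ]
        ring
      simp_rw [e]
      rw [sum_sq_seidel_apply hSs hsq (fun c => S a' c * ψ c x)]
      have hle : ∑ c, (S a' c * ψ c x) ^ 2 ≤ ∑ c, S a' c ^ 2 := by
        refine Finset.sum_le_sum fun c _ => ?_
        rw [mul_pow]
        calc S a' c ^ 2 * ψ c x ^ 2 ≤ S a' c ^ 2 * 1 :=
              mul_le_mul_of_nonneg_left (hψb c x) (sq_nonneg _)
          _ = S a' c ^ 2 := mul_one _
      nlinarith [sq_nonneg (∑ c, S a' c * ψ c x), mul_le_mul_of_nonneg_left hle hn0]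
    have hS2 : ∀ a' : V, ∑ c, S a' c ^ 2 ≤ n := by
      intro a'
      calc ∑ c, S a' c ^ 2 ≤ ∑ _c : V, (1 : ℝ) := Finset.sum_le_sum fun c _ => by
              have h := hSb a' c
              rw [← sq_abs]
              nlinarith [abs_nonneg (S a' c)]
        _ = n := by simp [hn]
    calc ∑ a', ∑ b', T x (a', b') ^ 2 ≤ ∑ a' : V, n * ∑ c, S a' c ^ 2 :=
          Finset.sum_le_sum fun a' _ => hinner a'
      _ ≤ ∑ _a' : V, n * n := Finset.sum_le_sum fun a' _ => mul_le_mul_of_nonneg_left (hS2 a') hn0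
      _ = n ^ 3 := by simp [hn]; ring
  -- (4) AM–GM: `Σ_{x,x'} v_x v_{x'} T² ≤ Σ_x v_x² Σ_{x'} T²`
  have hTsymm : ∀ x x', T x x' = T x' x := by
    intro x x'
    rw [hT]
    exact Finset.sum_congr rfl fun c _ => mul_comm _ _
  have hAMGM : ∑ x : V × V, ∑ x' : V × V, v x * v x' * T x x' ^ 2 ≤
      ∑ x : V × V, v x ^ 2 * ∑ x' : V × V, T x x' ^ 2 := by
    have h1 : ∑ x : V × V, ∑ x' : V × V, v x * v x' * T x x' ^ 2 ≤
        ∑ x : V × V, ∑ x' : V × V, (v x ^ 2 * T x x' ^ 2 + v x' ^ 2 * T x x' ^ 2) / 2 := by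
      refine Finset.sum_le_sum fun x _ => Finset.sum_le_sum fun x' _ => ?_
      nlinarith [mul_nonneg (sq_nonneg (v x - v x')) (sq_nonneg (T x x'))]
    have h2 : ∑ x : V × V, ∑ x' : V × V, v x' ^ 2 * T x x' ^ 2 =
        ∑ x : V × V, ∑ x' : V × V, v x ^ 2 * T x x' ^ 2 := by
      rw [Finset.sum_comm]
      refine Finset.sum_congr rfl fun x _ => Finset.sum_congr rfl fun x' _ => ?_
      rw [hTsymm x' x]
    have h3 : ∑ x : V × V, ∑ x' : V × V, (v x ^ 2 * T x x' ^ 2 + v x' ^ 2 * T x x' ^ 2) / 2 =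
        ∑ x : V × V, ∑ x' : V × V, v x ^ 2 * T x x' ^ 2 := by
      have e : ∑ x : V × V, ∑ x' : V × V, (v x ^ 2 * T x x' ^ 2 + v x' ^ 2 * T x x' ^ 2) / 2 =
          (∑ x : V × V, ∑ x' : V × V, v x ^ 2 * T x x' ^ 2 +
            ∑ x : V × V, ∑ x' : V × V, v x' ^ 2 * T x x' ^ 2) / 2 := by
        rw [← Finset.sum_add_distrib, Finset.sum_div]
        refine Finset.sum_congr rfl fun x _ => ?_
        rw [← Finset.sum_add_distrib, Finset.sum_div]
      rw [e, h2]
      ring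
    rw [h3] at h1
    refine h1.trans (le_of_eq ?_)
    exact Finset.sum_congr rfl fun x _ => by rw [Finset.mul_sum]
  -- (5) `Σ W² ≤ n³ Σ v²`
  have hWbound : ∑ y : V × V, W y.1 y.2 ^ 2 ≤ n ^ 3 * ∑ x : V × V, v x ^ 2 := by
    rw [hWsq]
    refine hAMGM.trans ?_
    rw [Finset.mul_sum]
    refine Finset.sum_le_sum fun x _ => ?_
    rw [mul_comm]
    exact mul_le_mul_of_nonneg_right (hrow x) (sq_nonneg _)
  -- (6) Cauchy–Schwarz and conclusion
  have hCS : (∑ y : V × V, v y * W y.1 y.2) ^ 2 ≤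
      (∑ y : V × V, v y ^ 2) * ∑ y : V × V, W y.1 y.2 ^ 2 :=
    Finset.sum_mul_sq_le_sq_mul_sq _ _ _
  set A : ℝ := ∑ y : V × V, v y ^ 2 with hA
  have hA0 : 0 ≤ A := Finset.sum_nonneg fun y _ => sq_nonneg _
  have hAeq : ∑ a, ∑ b, Vm a b ^ 2 = A := by rw [hA, Fintype.sum_prod_type]
  set X : ℝ := ∑ y : V × V, v y * W y.1 y.2 with hX
  have hX2 : X ^ 2 ≤ (n * Real.sqrt n * A) ^ 2 := by
    have e : (n * Real.sqrt n * A) ^ 2 = n ^ 3 * A ^ 2 := by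
      rw [mul_pow, mul_pow, Real.sq_sqrt hn0]; ring
    rw [e]
    calc X ^ 2 ≤ A * ∑ y : V × V, W y.1 y.2 ^ 2 := hCS
      _ ≤ A * (n ^ 3 * A) := mul_le_mul_of_nonneg_left hWbound hA0
      _ = n ^ 3 * A ^ 2 := by ring
  rw [hform, hAeq]
  have hB0 : 0 ≤ n * Real.sqrt n * A := by positivity
  exact abs_le.2 (abs_le_of_sq_le_sq' hX2 hB0)

end Naive

/-! ### Every conference graph at level 2 -/

section Conference

variable {V : Type*} [Fintype V] [DecidableEq V]

/-- **`las⁽²⁾(Ḡ) ≥ 2⁻⁸ n^{1/4}` for every graph `G` on `n` vertices whose Seidel matrix is a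
conference matrix with zero row sums** (`S² = nI − J`, `S𝟙 = 0`): the naive `n^{3/2}` bound on the
4-cycle form fed into `conference_card_mul_le_lasserreStableBound_two` with `α = 2⁻⁸ n^{-3/4}`;
small `n` by `las⁽²⁾ ≥ 1` (or `≥ 0` on the empty vertex set). [folklore] -/
theorem conference_lasserre_two_ge_quarter (G : _root_.SimpleGraph V) [DecidableRel G.Adj]
    {S : Matrix V V ℝ}
    (hS : ∀ a b, S a b = if a = b then 0 else if G.Adj a b then 1 else -1)
    (hrow : ∀ a, ∑ b, S a b = 0)
    (hsq : S * S = (Fintype.card V : ℝ) • (1 : Matrix V V ℝ) - of fun _ _ => 1) :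
    (1 / 256 : ℝ) * (Fintype.card V : ℝ) ^ ((1 : ℝ) / 4) ≤ lasserreStableBound Gᶜ 2 := by
  set P : ℝ := (Fintype.card V : ℝ) with hP
  have hP0 : 0 ≤ P := Nat.cast_nonneg _
  rcases isEmpty_or_nonempty V with hV | hV
  · have h0 : P = 0 := by rw [hP]; exact_mod_cast (Fintype.card_eq_zero_iff.2 hV)
    rw [h0, Real.zero_rpow (by norm_num), mul_zero]
    exact lasserreStableBound_nonneg _ _ (by norm_num)
  obtain ⟨v0⟩ := hV
  set r : ℝ := P ^ ((1 : ℝ) / 4) with hr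
  have hr0' : 0 ≤ r := Real.rpow_nonneg hP0 _
  have hr4 : r ^ 4 = P := by
    rw [hr, ← Real.rpow_natCast, ← Real.rpow_mul hP0]; norm_num
  have hr2 : Real.sqrt P = r ^ 2 := by
    rw [hr, ← Real.rpow_natCast, ← Real.rpow_mul hP0, Real.sqrt_eq_rpow]; norm_num
  by_cases hbig : 256 ≤ r
  swap
  · -- small `n`: `r/256 < 1 ≤ las⁽²⁾`
    have hlt : (1 / 256 : ℝ) * r < 1 := by
      have := lt_of_not_ge hbig
      linarith
    have h1 : (1 : ℝ) ≤ lasserreStableBound Gᶜ 2 := one_le_lasserreStableBound_two _ v0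
    linarith
  -- large `n`
  have hr0 : 0 < r := by linarith
  have hSs : ∀ x y, S x y = S y x := by
    intro x y
    rw [hS x y, hS y x]
    by_cases h : x = y
    · subst h; simp
    · have h' : ¬ y = x := fun e => h e.symm
      simp only [h, h', if_false, G.adj_comm x y]
  have hSb : ∀ x y, |S x y| ≤ 1 := by
    intro x y
    rw [hS]
    split_ifs <;> simp
  set α : ℝ := 1 / 256 * (r ^ 3)⁻¹ with hα
  have hα0 : 0 < α := by positivity
  have hrinv : r⁻¹ ≤ 1 / 256 := by
    rw [inv_eq_one_div, div_le_div_iff₀ hr0 (by norm_num : (0:ℝ) < 256)]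
    linarith
  have h1 : α ≤ 1 / 1024 := by
    have e : α = 1 / 256 * (r⁻¹) ^ 3 := by rw [hα, inv_pow]
    rw [e]
    calc 1 / 256 * (r⁻¹) ^ 3 ≤ 1 / 256 * (1 / 256) ^ 3 := by gcongr
      _ ≤ 1 / 1024 := by norm_num
  have h2 : α * Real.sqrt (Fintype.card V) ≤ 1 / 32768 := by
    rw [← hP, hr2]
    have e : α * r ^ 2 = 1 / 256 * r⁻¹ := by rw [hα]; field_simp
    rw [e]
    calc 1 / 256 * r⁻¹ ≤ 1 / 256 * (1 / 256) := by gcongr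
      _ ≤ 1 / 32768 := by norm_num
  have h3 : α ^ 2 * Fintype.card V ≤ 1 / 2 ^ 30 := by
    rw [← hP, ← hr4]
    have e : α ^ 2 * r ^ 4 = (1 / 256) ^ 2 * (r⁻¹) ^ 2 := by rw [hα]; field_simp
    rw [e]
    calc (1 / 256 : ℝ) ^ 2 * (r⁻¹) ^ 2 ≤ (1 / 256) ^ 2 * (1 / 256) ^ 2 := by gcongr
      _ ≤ 1 / 2 ^ 30 := by norm_num
  have h4 : α ^ 3 * (Fintype.card V : ℝ) ^ 2 ≤ 1 / 2 ^ 30 := by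
    rw [← hP, ← hr4]
    have e : α ^ 3 * (r ^ 4) ^ 2 = (1 / 256) ^ 3 * r⁻¹ := by rw [hα]; field_simp
    rw [e]
    calc (1 / 256 : ℝ) ^ 3 * r⁻¹ ≤ (1 / 256) ^ 3 * (1 / 256) := by gcongr
      _ ≤ 1 / 2 ^ 30 := by norm_num
  have h5 : 1 ≤ α ^ 2 * (Fintype.card V : ℝ) ^ 2 := by
    rw [← hP, ← hr4]
    have e : α ^ 2 * (r ^ 4) ^ 2 = ((1 / 256) * r) ^ 2 := by rw [hα]; field_simp
    rw [e]
    have : (1 : ℝ) ≤ 1 / 256 * r := by linarith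
    exact one_le_pow₀ this
  have hK : α ^ 2 * (P * Real.sqrt P) ≤ 1 / 16384 := by
    rw [hr2, ← hr4]
    have e : α ^ 2 * (r ^ 4 * r ^ 2) = (1 / 256) ^ 2 := by rw [hα]; field_simp
    rw [e]; norm_num
  have hΘ : ∀ Vm : Matrix V V ℝ, (∀ x y, Vm x y = Vm y x) → (∀ x, Vm x x = 0) →
      |∑ a, ∑ b, ∑ c, ∑ d, Vm a b * Vm c d * (S a c * S a d * S b c * S b d)| ≤
        (P * Real.sqrt P) * ∑ a, ∑ b, Vm a b ^ 2 := by
    intro Vm _ _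
    exact abs_thetaForm_le_naive hSs hSb hsq Vm
  have hmain := conference_card_mul_le_lasserreStableBound_two G hS hrow hsq hα0
    h1 h2 h3 h4 h5 hK hΘ
  have e : (Fintype.card V : ℝ) * α = 1 / 256 * r := by
    rw [← hP, ← hr4, hα]; field_simp
  rw [e] at hmain
  exact hmain

end Conference

/-! ### The Paley graph at level 2 without FKM -/

section Paley

open Classical in
/-- **`las⁽²⁾(P_p) ≥ 2⁻⁸ p^{1/4}`** for every prime `p ≡ 1 (mod 4)`, from `S² = pI − J` alone
(the naive `p^{3/2}` bound on the 4-cycle form fed into the tree's conference-graph theorem with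
`α = 2⁻⁸ p^{-3/4}`; small `p` by `las⁽²⁾ ≥ 1`). [folklore] -/
theorem paley_lasserre_two_ge_quarter {p : ℕ} (hp : p.Prime) (hp4 : p % 4 = 1) :
    (1 / 256 : ℝ) * (p : ℝ) ^ ((1 : ℝ) / 4) ≤ lasserreStableBound (paleyGraph p) 2 := by
  obtain ⟨m, rfl⟩ : ∃ m, p = m + 1 := ⟨p - 1, (Nat.succ_pred_eq_of_pos hp.pos).symm⟩
  haveI : Fact (m + 1).Prime := ⟨hp⟩
  rw [← lasserreStableBound_compl_paleyGraph hp hp4 (by norm_num : 1 ≤ 2)]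
  set S : Matrix (Fin (m + 1)) (Fin (m + 1)) ℝ :=
    of fun x y => if x = y then 0 else if (paleyGraph (m + 1)).Adj x y then 1 else -1 with hSdef
  have hS : ∀ a b, S a b = if a = b then 0 else if (paleyGraph (m + 1)).Adj a b then 1 else -1 :=
    fun a b => rfl
  have hrow : ∀ a : Fin (m + 1), ∑ b, S a b = 0 := fun a => sum_paley_seidel m hp4 hS a
  have hsq := paley_seidel_mul_self m hp4 hS
  have h := conference_lasserre_two_ge_quarter (paleyGraph (m + 1)) hS hrow hsq
  rwa [Fintype.card_fin] at h

/-- The `t = 2` instance of crux `PaleySosRung` (stmt-PneNP-9817) in its own shape, FKM-free: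
`η = 1/8`, `p₀ = 2^64` (`p^{1/8} ≤ 2⁻⁸ p^{1/4}` once `p^{1/8} ≥ 2⁸`). [folklore] -/
theorem paleySosRung_level_two_quarter :
    ∃ η : ℝ, 0 < η ∧ ∃ p₀ : ℕ, ∀ p ≥ p₀, p.Prime → p % 4 = 1 →
      (p : ℝ) ^ η ≤ lasserreStableBound
        (_root_.SimpleGraph.fromRel fun x y : Fin p => IsSquare (x - y)) 2 := by
  refine ⟨1 / 8, by norm_num, 2 ^ 64, fun p hp₀ hp hp4 => ?_⟩
  rw [← paleyGraph_eq_fromRel]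
  refine le_trans ?_ (paley_lasserre_two_ge_quarter hp hp4)
  have hp0 : (0 : ℝ) ≤ p := Nat.cast_nonneg p
  have hquarter : (p : ℝ) ^ ((1 : ℝ) / 4) = (p : ℝ) ^ ((1 : ℝ) / 8) * (p : ℝ) ^ ((1 : ℝ) / 8) := by
    rw [← Real.rpow_add_of_nonneg hp0 (by norm_num) (by norm_num)]; norm_num
  have hbase : ((2 : ℝ) ^ 64) ≤ (p : ℝ) := by exact_mod_cast hp₀
  have h8 : (256 : ℝ) ≤ (p : ℝ) ^ ((1 : ℝ) / 8) := by
    have h1 : ((2 : ℝ) ^ 64) ^ ((1 : ℝ) / 8) ≤ (p : ℝ) ^ ((1 : ℝ) / 8) :=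
      Real.rpow_le_rpow (by positivity) hbase (by norm_num)
    have e : ((2 : ℝ) ^ 64) ^ ((1 : ℝ) / 8) = 256 := by
      rw [← Real.rpow_natCast, ← Real.rpow_mul (by norm_num)]; norm_num
    rwa [e] at h1
  have hx0 : 0 ≤ (p : ℝ) ^ ((1 : ℝ) / 8) := Real.rpow_nonneg hp0 _
  calc (p : ℝ) ^ ((1 : ℝ) / 8) = (1 / 256) * (256 * (p : ℝ) ^ ((1 : ℝ) / 8)) := by ring
    _ ≤ (1 / 256) * ((p : ℝ) ^ ((1 : ℝ) / 8) * (p : ℝ) ^ ((1 : ℝ) / 8)) := by gcongr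
    _ = (1 / 256) * (p : ℝ) ^ ((1 : ℝ) / 4) := by rw [hquarter]

end Paley

end Literature.Combinatorics.SimpleGraph

end
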